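import Mathlib
import Summits.Schanuel.Schanuel.Theses.RigidCore
import Literature.NumberTheory.Transcendental.GammaFields
import Literature.NumberTheory.Transcendental.GammaFieldsEcl
import Literature.NumberTheory.Transcendental.GammaStrongDescent
import Literature.NumberTheory.Transcendental.ZilberFieldHomogeneity
import Literature.NumberTheory.Transcendental.SchanuelEclEmptyProofs

/-!
# `(R) ⟹ stub B`: the crux `RigidCore.SchanuelOnLogFreeCore` implies `stub_periodGenericOverCore`

Refuter evidence for drefute stmt-Schanuel-0970 / line `generic-period-fibre` (positive lemma, not a
stub, not the crux): together with the skeleton's sorry-free `horizontalSplit` (A ∧ B ⟹ (R)) and the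
trivial `(R) ⟹ A` this makes the line's split EXACT: `(R) ⟺ A ∧ B`. In particular stub B is not an
over-strengthening of the crux, and any refutation of B refutes (R) and Schanuel's conjecture.

Proof (hull count inside `C_EA`, in the Bays–Kirby predimension calculus of `GammaFields.lean`):
* `predim_bot_nonneg` : (R) gives `δ(X/0) ≥ 0` for every finitely generated `X ≤ C_EA`
  (the proof of `ZilberHomogeneity.isStrong_bot_of_schanuelProperty`, localised to `C_EA`);
* `predim_bot_sup_eq_zero` : sums of `δ = 0` subspaces of `C_EA` have `δ = 0` (addition formula +
  submodularity);
* `hasHull_of_mem_M` : every element of the kernel-free core `M` is algebraic over the Γ-field of a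
  finitely generated `V ≤ M` with `δ(V/0) = 0` — the set of such elements is an `exp`-closed,
  relatively algebraically closed intermediate field (`hullField`), hence contains `M = sInf {…}`;
* `stubB_of_crux` : for `x ⊂ C_EA` independent modulo `M`, finite character of the algebraic matroid
  gives a finite `c ⊂ M` carrying `trdeg_M M(x, eˣ)`; with `V` a hull of `c`:
  `n = ldim(x/M) ≤ ldim(x/V) ≤ td(x/V) ≤ relRank_M(x ∪ eˣ) = trdeg_M M(x, eˣ)`.
-/

noncomputable section

open Set
open Literature.NumberTheory.Transcendental
open Literature.NumberTheory.Transcendental.GammaField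

namespace DrefuteGPF

/-- kernel-free core `M`, inlined exactly as in the stubs -/
abbrev M : IntermediateField ℚ ℂ :=
  sInf {K : IntermediateField ℚ ℂ | (∀ w ∈ K, Complex.exp w ∈ K) ∧ ∀ w : ℂ, IsAlgebraic K w → w ∈ K}

/-- log-free core `C_EA`, the crux decl's set-builder -/
abbrev CEA : IntermediateField ℚ ℂ :=
  sInf {K : IntermediateField ℚ ℂ | (2 * ↑Real.pi * Complex.I : ℂ) ∈ K ∧
    (∀ w ∈ K, Complex.exp w ∈ K) ∧ ∀ w : ℂ, IsAlgebraic K w → w ∈ K}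

/-- Stub B, verbatim registered signature. -/
def StubB : Prop :=
  ∀ (n : ℕ) (x : Fin n → ℂ), (∀ i, x i ∈ (sInf {K : IntermediateField ℚ ℂ | (2 * ↑Real.pi * Complex.I : ℂ) ∈ K ∧ (∀ w ∈ K, Complex.exp w ∈ K) ∧ ∀ w : ℂ, IsAlgebraic K w → w ∈ K} : IntermediateField ℚ ℂ)) → LinearIndependent ℚ ((Submodule.span ℚ ((sInf {K : IntermediateField ℚ ℂ | (∀ w ∈ K, Complex.exp w ∈ K) ∧ ∀ w : ℂ, IsAlgebraic K w → w ∈ K} : IntermediateField ℚ ℂ) : Set ℂ)).mkQ ∘ x) → (n : Cardinal) ≤ Algebra.trdeg ↥(sInf {K : IntermediateField ℚ ℂ | (∀ w ∈ K, Complex.exp w ∈ K) ∧ ∀ w : ℂ, IsAlgebraic K w → w ∈ K} : IntermediateField ℚ ℂ) ↥(IntermediateField.adjoin ↥(sInf {K : IntermediateField ℚ ℂ | (∀ w ∈ K, Complex.exp w ∈ K) ∧ ∀ w : ℂ, IsAlgebraic K w → w ∈ K} : IntermediateField ℚ ℂ) (Set.range x ∪ Set.range (Complex.exp ∘ x)))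

/-- The crux (R). -/
abbrev Crux : Prop := Summit.Schanuel.Schanuel.Theses.RigidCore.SchanuelOnLogFreeCore

/-! ## Elementary facts about `M` and `C_EA` -/

theorem M_exp {w : ℂ} (hw : w ∈ M) : Complex.exp w ∈ M := by
  rw [IntermediateField.mem_sInf] at hw ⊢
  exact fun K hK => hK.1 w (hw K hK)

theorem M_rac {w : ℂ} (hw : IsAlgebraic M w) : w ∈ M := by
  rw [IntermediateField.mem_sInf]
  intro K hK
  have hle : M ≤ K := sInf_le hK
  letI : Algebra M K := (IntermediateField.inclusion hle).toRingHom.toAlgebra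
  haveI : IsScalarTower M K ℂ := IsScalarTower.of_algebraMap_eq (fun _ => rfl)
  exact hK.2 w (hw.tower_top K)

theorem M_le_CEA : M ≤ CEA :=
  sInf_le_sInf fun _ hK => hK.2

/-- `M` as a `ℚ`-subspace — literally the `span` occurring in stub B's hypothesis. -/
abbrev ΛM : Submodule ℚ ℂ := Submodule.span ℚ (M : Set ℂ)

/-- `C_EA` as a `ℚ`-subspace. -/
abbrev ΛC : Submodule ℚ ℂ := Submodule.span ℚ (CEA : Set ℂ)

theorem ΛM_eq : ΛM = Subalgebra.toSubmodule M.toSubalgebra :=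
  Submodule.span_eq (Subalgebra.toSubmodule M.toSubalgebra)

theorem ΛC_eq : ΛC = Subalgebra.toSubmodule CEA.toSubalgebra :=
  Submodule.span_eq (Subalgebra.toSubmodule CEA.toSubalgebra)

theorem mem_ΛM {a : ℂ} : a ∈ ΛM ↔ a ∈ M := by
  rw [ΛM_eq]; rfl

theorem mem_ΛC {a : ℂ} : a ∈ ΛC ↔ a ∈ CEA := by
  rw [ΛC_eq]; rfl

theorem ΛM_le_ΛC : ΛM ≤ ΛC :=
  Submodule.span_mono fun _ ha => M_le_CEA ha

theorem gens_subset_M {V : Submodule ℚ ℂ} (hV : V ≤ ΛM) : gens V ⊆ (M : Set ℂ) := by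
  rintro a (ha | ⟨b, hb, rfl⟩)
  · exact mem_ΛM.1 (hV ha)
  · exact M_exp (mem_ΛM.1 (hV hb))

/-! ## (R) ⟹ `δ(X/0) ≥ 0` for finitely generated `X ≤ C_EA` -/

theorem predim_bot_nonneg (hR : Crux) {X : Submodule ℚ ℂ} (hXC : X ≤ ΛC)
    (hfg : IsFG (⊥ : Submodule ℚ ℂ) X) : 0 ≤ predim ⊥ X := by
  classical
  haveI := hfg.finite
  set n := ldim (⊥ : Submodule ℚ ℂ) X with hn
  let b := Module.finBasis ℚ ↥(X.map (⊥ : Submodule ℚ ℂ).mkQ)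
  have hcard : Module.finrank ℚ ↥(X.map (⊥ : Submodule ℚ ℂ).mkQ) = n := rfl
  have hmem : ∀ i : Fin n, ∃ y ∈ X, (⊥ : Submodule ℚ ℂ).mkQ y =
      (b (Fin.cast hcard.symm i) : ℂ ⧸ (⊥ : Submodule ℚ ℂ)) := fun i =>
    Submodule.mem_map.1 (b (Fin.cast hcard.symm i)).2
  choose x hxX hxb using hmem
  have hx : LinearIndependent ℚ ((⊥ : Submodule ℚ ℂ).mkQ ∘ x) := by
    have hb : LinearIndependent ℚ
        (fun i : Fin n => ((b (Fin.cast hcard.symm i) : ↥(X.map (⊥ : Submodule ℚ ℂ).mkQ)) :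
          ℂ ⧸ (⊥ : Submodule ℚ ℂ))) :=
      (b.linearIndependent.map' (X.map (⊥ : Submodule ℚ ℂ).mkQ).subtype
        (Submodule.ker_subtype _)).comp _ (Fin.cast_injective _)
    convert hb using 1
    funext i
    exact hxb i
  have hx' : LinearIndependent ℚ x := LinearIndependent.of_comp _ hx
  have hxC : ∀ i, x i ∈ CEA := fun i => mem_ΛC.1 (hXC (hxX i))
  have h1 : (n : ℕ∞) ≤ (algMatroid ℂ).eRk (range x ∪ range (Complex.exp ∘ x)) :=
    ZilberHomogeneity.natCast_le_eRk_of_le_trdeg (hR n x hxC hx')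
  have h2 : (algMatroid ℂ).eRk (range x ∪ range (Complex.exp ∘ x)) ≤ td ⊥ X := by
    rw [ZilberHomogeneity.td_bot]
    refine (algMatroid ℂ).eRk_mono ?_
    rintro a (⟨i, rfl⟩ | ⟨i, rfl⟩)
    · exact mem_gens_of_mem (hxX i)
    · exact exp_mem_gens (hxX i)
  have hne : td ⊥ X ≠ ⊤ := td_ne_top hfg
  have h3 : n ≤ (td ⊥ X).toNat := by
    have := h1.trans h2
    rw [← ENat.coe_toNat hne] at this
    exact_mod_cast this
  have h4 : predim ⊥ X = ((td ⊥ X).toNat : ℤ) - (n : ℤ) := rfl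
  omega

/-- Sums of `δ = 0` finitely generated subspaces of `C_EA` have `δ = 0`. -/
theorem predim_bot_sup_eq_zero (hR : Crux) {V W : Submodule ℚ ℂ} (hVC : V ≤ ΛC) (hWC : W ≤ ΛC)
    (hVfg : IsFG (⊥ : Submodule ℚ ℂ) V) (hWfg : IsFG (⊥ : Submodule ℚ ℂ) W)
    (hV0 : predim ⊥ V = 0) (hW0 : predim ⊥ W = 0) : predim ⊥ (V ⊔ W) = 0 := by
  have hfg : IsFG (⊥ : Submodule ℚ ℂ) (V ⊔ W) := hVfg.sup hWfg
  have hge : 0 ≤ predim ⊥ (V ⊔ W) := predim_bot_nonneg hR (sup_le hVC hWC) hfg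
  have hadd : predim ⊥ (V ⊔ W) = predim ⊥ V + predim V (V ⊔ W) :=
    predim_add bot_le le_sup_left hfg
  rw [predim_sup_left] at hadd
  have hWfg' : IsFG (W ⊓ V) W := hWfg.of_le_left bot_le
  have hsub : predim V W ≤ predim (W ⊓ V) W := by
    have := predim_sup_le W V hWfg'
    rwa [predim_sup_right] at this
  have hadd2 : predim ⊥ W = predim ⊥ (W ⊓ V) + predim (W ⊓ V) W :=
    predim_add bot_le inf_le_left hWfg
  have hinf : 0 ≤ predim ⊥ (W ⊓ V) :=
    predim_bot_nonneg hR (inf_le_left.trans hWC) (hWfg.mono inf_le_left)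
  linarith

/-! ## Hulls inside `M` -/

/-- `a` is algebraic over the Γ-field of a `δ = 0` finitely generated subspace of `M`. -/
def HasHull (a : ℂ) : Prop :=
  ∃ V : Submodule ℚ ℂ, V ≤ ΛM ∧ IsFG (⊥ : Submodule ℚ ℂ) V ∧ predim ⊥ V = 0 ∧ a ∈ acl (gens V)

theorem hasHull_algebraMap (q : ℚ) : HasHull (algebraMap ℚ ℂ q) :=
  ⟨⊥, bot_le, isFG_self ⊥, predim_self ⊥, algebraMap_mem_acl q⟩

theorem HasHull.pair (hR : Crux) {a b : ℂ} (ha : HasHull a) (hb : HasHull b) :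
    ∃ V : Submodule ℚ ℂ, V ≤ ΛM ∧ IsFG (⊥ : Submodule ℚ ℂ) V ∧ predim ⊥ V = 0 ∧
      a ∈ acl (gens V) ∧ b ∈ acl (gens V) := by
  obtain ⟨V, hV, hVfg, hV0, haV⟩ := ha
  obtain ⟨W, hW, hWfg, hW0, hbW⟩ := hb
  exact ⟨V ⊔ W, sup_le hV hW, hVfg.sup hWfg,
    predim_bot_sup_eq_zero hR (hV.trans ΛM_le_ΛC) (hW.trans ΛM_le_ΛC) hVfg hWfg hV0 hW0,
    acl_mono (gens_mono le_sup_left) haV, acl_mono (gens_mono le_sup_right) hbW⟩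

theorem HasHull.add (hR : Crux) {a b : ℂ} (ha : HasHull a) (hb : HasHull b) : HasHull (a + b) := by
  obtain ⟨V, hV, hVfg, hV0, haV, hbV⟩ := ha.pair hR hb
  exact ⟨V, hV, hVfg, hV0, add_mem_acl haV hbV⟩

theorem HasHull.mul (hR : Crux) {a b : ℂ} (ha : HasHull a) (hb : HasHull b) : HasHull (a * b) := by
  obtain ⟨V, hV, hVfg, hV0, haV, hbV⟩ := ha.pair hR hb
  exact ⟨V, hV, hVfg, hV0, mul_mem_acl haV hbV⟩

theorem HasHull.inv {a : ℂ} (ha : HasHull a) : HasHull a⁻¹ := by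
  obtain ⟨V, hV, hVfg, hV0, haV⟩ := ha
  exact ⟨V, hV, hVfg, hV0, inv_mem_acl haV⟩

/-- `exp`-closure of the hull property (one new exponential over an algebraic point costs nothing:
`td(a, eᵃ/V) ≤ 1 = ldim`, so `δ ≤ 0`, and `δ ≥ 0` by (R)). -/
theorem HasHull.exp (hR : Crux) {a : ℂ} (haM : a ∈ M) (ha : HasHull a) :
    HasHull (Complex.exp a) := by
  obtain ⟨V, hV, hVfg, hV0, haV⟩ := ha
  set V' : Submodule ℚ ℂ := V ⊔ Submodule.span ℚ {a} with hV'
  have hV'M : V' ≤ ΛM :=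
    sup_le hV ((Submodule.span_singleton_le_iff_mem _ _).2 (mem_ΛM.2 haM))
  have hV'fg : IsFG (⊥ : Submodule ℚ ℂ) V' := hVfg.sup (isFG_span_of_finite ⊥ (finite_singleton a))
  have htd : td V (Submodule.span ℚ {a}) ≤ 1 := by
    rw [td_span_singleton]
    have ha' : a ∈ (algMatroid ℂ).closure
        ({Literature.ModelTheory.ExponentialFields.ExponentialRing.exp a} ∪ gens V) :=
      (algMatroid ℂ).closure_subset_closure subset_union_right haV
    rw [(algMatroid ℂ).relRank_insert_eq_of_mem_closure ha']
    refine ((algMatroid ℂ).relRank_le_encard_diff _ _).trans ?_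
    refine (encard_le_encard sdiff_subset).trans ?_
    rw [encard_singleton]
  have h0 : predim V (Submodule.span ℚ {a}) ≤ 0 := predim_span_singleton_nonpos_of_td_le_one htd
  have hadd : predim ⊥ V' = predim ⊥ V + predim V V' := predim_add bot_le le_sup_left hV'fg
  rw [hV', predim_sup_left] at hadd
  have hge : 0 ≤ predim ⊥ V' := predim_bot_nonneg hR (hV'M.trans ΛM_le_ΛC) hV'fg
  refine ⟨V', hV'M, hV'fg, by rw [hV'] at hge ⊢; linarith, ?_⟩
  exact subset_acl _ (exp_mem_gens (Submodule.mem_sup_right (Submodule.mem_span_singleton_self a)))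

/-- A finite set of elements with hulls has a common hull. -/
theorem hasHull_finset (hR : Crux) (t : Finset ℂ) (ht : ∀ c ∈ t, HasHull c) :
    ∃ V : Submodule ℚ ℂ, V ≤ ΛM ∧ IsFG (⊥ : Submodule ℚ ℂ) V ∧ predim ⊥ V = 0 ∧
      (↑t : Set ℂ) ⊆ acl (gens V) := by
  classical
  induction t using Finset.induction_on with
  | empty => exact ⟨⊥, bot_le, isFG_self ⊥, predim_self ⊥, by simp⟩
  | insert a t hat ih =>
    obtain ⟨W, hW, hWfg, hW0, htW⟩ := ih (fun c hc => ht c (Finset.mem_insert_of_mem hc))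
    obtain ⟨V, hV, hVfg, hV0, haV⟩ := ht a (Finset.mem_insert_self a t)
    refine ⟨V ⊔ W, sup_le hV hW, hVfg.sup hWfg,
      predim_bot_sup_eq_zero hR (hV.trans ΛM_le_ΛC) (hW.trans ΛM_le_ΛC) hVfg hWfg hV0 hW0, ?_⟩
    rw [Finset.coe_insert]
    exact insert_subset (acl_mono (gens_mono le_sup_left) haV)
      (htW.trans (acl_mono (gens_mono le_sup_right)))

/-- The elements of `M` having a hull form an intermediate field … -/
def hullField (hR : Crux) : IntermediateField ℚ ℂ where
  carrier := {a | a ∈ M ∧ HasHull a}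
  mul_mem' := fun ha hb => ⟨mul_mem ha.1 hb.1, ha.2.mul hR hb.2⟩
  one_mem' := ⟨one_mem _, by simpa using hasHull_algebraMap 1⟩
  add_mem' := fun ha hb => ⟨add_mem ha.1 hb.1, ha.2.add hR hb.2⟩
  zero_mem' := ⟨zero_mem _, by simpa using hasHull_algebraMap 0⟩
  algebraMap_mem' := fun q => ⟨algebraMap_mem M q, hasHull_algebraMap q⟩
  inv_mem' := fun _ ha => ⟨inv_mem ha.1, ha.2.inv⟩

theorem mem_hullField {hR : Crux} {a : ℂ} : a ∈ hullField hR ↔ a ∈ M ∧ HasHull a := Iff.rfl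

theorem hullField_le_M (hR : Crux) : hullField hR ≤ M := fun _ ha => ha.1

/-- … which is `exp`-closed … -/
theorem exp_mem_hullField (hR : Crux) : ∀ w ∈ hullField hR, Complex.exp w ∈ hullField hR :=
  fun _ hw => ⟨M_exp hw.1, hw.2.exp hR hw.1⟩

/-- … and relatively algebraically closed (finite character of algebraic dependence + common hulls). -/
theorem rac_hullField (hR : Crux) : ∀ w : ℂ, IsAlgebraic (hullField hR) w → w ∈ hullField hR := by
  intro w hw
  -- `w ∈ M`
  have hwM : w ∈ M := by
    have hle : hullField hR ≤ M := hullField_le_M hR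
    letI : Algebra (hullField hR) M := (IntermediateField.inclusion hle).toRingHom.toAlgebra
    haveI : IsScalarTower (hullField hR) M ℂ := IsScalarTower.of_algebraMap_eq (fun _ => rfl)
    exact M_rac (hw.tower_top M)
  -- `w` is algebraic over finitely many elements of the hull field
  have hw' : w ∈ acl ((hullField hR : IntermediateField ℚ ℂ) : Set ℂ) := by
    rw [mem_acl_iff, ← IntermediateField.coe_toSubalgebra, Algebra.adjoin_eq]
    exact hw
  obtain ⟨I, hIN, hIfin, -, hwI⟩ := (algMatroid ℂ).exists_mem_finite_closure_of_mem_closure hw'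
  obtain ⟨V, hV, hVfg, hV0, hIV⟩ := hasHull_finset hR hIfin.toFinset
    (fun c hc => (hIN (hIfin.mem_toFinset.1 hc)).2)
  refine ⟨hwM, V, hV, hVfg, hV0, ?_⟩
  have hI : I ⊆ acl (gens V) := fun c hc => hIV (hIfin.mem_toFinset.2 hc)
  exact acl_subset_acl_of_subset hI hwI

/-- Hence `M ≤ hullField`: **every element of `M` has a `δ = 0` hull inside `M`.** -/
theorem hasHull_of_mem_M (hR : Crux) {a : ℂ} (ha : a ∈ M) : HasHull a := by
  have hle : M ≤ hullField hR := sInf_le ⟨exp_mem_hullField hR, rac_hullField hR⟩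
  exact (hle ha).2

/-! ## The main theorem -/

/-- **(R) ⟹ stub B**: Schanuel on the log-free core implies relative Schanuel of `C_EA` over the
kernel-free core `M`. -/
theorem stubB_of_crux (hR : Crux) : StubB := by
  classical
  intro n x hxC hli
  set S : Set ℂ := range x ∪ range (Complex.exp ∘ x) with hS
  set X : Submodule ℚ ℂ := Submodule.span ℚ (range x) with hX
  have hSfin : S.Finite := (finite_range x).union (finite_range _)
  -- (1) finite character: a basis `J` of `S` over `M`, and finitely many elements `c ⊂ M` carrying it
  obtain ⟨J, hJ⟩ := ((algMatroid ℂ).contract (M : Set ℂ)).exists_isBasis' S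
  have hρ : (algMatroid ℂ).relRank (M : Set ℂ) S = J.encard := by
    rw [Matroid.relRank_eq_eRk_contract, hJ.encard_eq_eRk]
  have hSclJ : S ⊆ (algMatroid ℂ).closure (J ∪ (M : Set ℂ)) := by
    intro a haS
    by_cases haM : a ∈ (M : Set ℂ)
    · exact (algMatroid ℂ).subset_closure (J ∪ (M : Set ℂ)) (fun _ _ => mem_univ _) (Or.inr haM)
    · have haE : a ∈ ((algMatroid ℂ).contract (M : Set ℂ)).E := by
        rw [Matroid.contract_ground]
        exact ⟨mem_univ a, haM⟩
      have h1 : a ∈ ((algMatroid ℂ).contract (M : Set ℂ)).closure S :=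
        ((algMatroid ℂ).contract (M : Set ℂ)).inter_ground_subset_closure S ⟨haS, haE⟩
      rw [← hJ.closure_eq_closure, Matroid.contract_closure_eq] at h1
      exact h1.1
  obtain ⟨I, hIJM, hIfin, -, hSI⟩ :=
    (algMatroid ℂ).exists_subset_finite_closure_of_subset_closure hSfin hSclJ
  set c : Set ℂ := I ∩ (M : Set ℂ) with hc
  have hcfin : c.Finite := hIfin.subset inter_subset_left
  have hcM : c ⊆ (M : Set ℂ) := inter_subset_right
  have hIsub : I ⊆ J ∪ c := fun a ha => (hIJM ha).elim Or.inl (fun haM => Or.inr ⟨ha, haM⟩)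
  -- (2) a hull `V` of `c` inside `M`
  obtain ⟨V, hV, hVfg, hV0, hcV⟩ := hasHull_finset hR hcfin.toFinset
    (fun a ha => hasHull_of_mem_M hR (hcM (hcfin.mem_toFinset.1 ha)))
  have hcV' : c ⊆ acl (gens V) := fun a ha => hcV (hcfin.mem_toFinset.2 ha)
  -- (3) over `gens V` the set `S` still has relative rank ≤ |J| = relRank_M S
  have hle1 : (algMatroid ℂ).relRank (gens V) S ≤ J.encard := by
    have hScl : S ⊆ (algMatroid ℂ).closure (J ∪ gens V) := by
      refine hSI.trans ((algMatroid ℂ).closure_subset_closure_of_subset_closure ?_)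
      refine hIsub.trans ?_
      rintro a (haJ | hac)
      · exact (algMatroid ℂ).subset_closure (J ∪ gens V) (fun _ _ => mem_univ _) (Or.inl haJ)
      · exact (algMatroid ℂ).closure_subset_closure subset_union_right (hcV' hac)
    calc (algMatroid ℂ).relRank (gens V) S ≤ (algMatroid ℂ).relRank (gens V) J :=
          (algMatroid ℂ).relRank_le_of_subset_closure _ hScl
      _ ≤ (J \ gens V).encard := (algMatroid ℂ).relRank_le_encard_diff _ _
      _ ≤ J.encard := encard_le_encard sdiff_subset
  -- (4) `td(X/V) ≤ relRank (gens V) S`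
  have htdle : td V X ≤ (algMatroid ℂ).relRank (gens V) S := by
    have h := td_span_le_relRank V (range x)
    rw [← range_comp] at h
    exact h
  -- (5) `δ(X/V) ≥ 0` from (R) and `δ(V/0) = 0`
  have hXC : X ≤ ΛC :=
    Submodule.span_le.2 (range_subset_iff.2 fun i => Submodule.subset_span (hxC i))
  have hXfg : IsFG (⊥ : Submodule ℚ ℂ) X := isFG_span_of_finite ⊥ (finite_range x)
  have hVXfg : IsFG (⊥ : Submodule ℚ ℂ) (V ⊔ X) := hVfg.sup hXfg
  have h0 : 0 ≤ predim ⊥ (V ⊔ X) :=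
    predim_bot_nonneg hR (sup_le (hV.trans ΛM_le_ΛC) hXC) hVXfg
  have hadd : predim ⊥ (V ⊔ X) = predim ⊥ V + predim V X := by
    rw [predim_add bot_le le_sup_left hVXfg, predim_sup_left]
  have hpVX : 0 ≤ predim V X := by linarith
  -- (6) `ldim(X/V) ≥ ldim(X/M) = n`
  have hldimM : ldim ΛM X = n := by
    rw [ldim, hX, Submodule.map_span, ← range_comp, finrank_span_eq_card hli, Fintype.card_fin]
  have hldim : n ≤ ldim V X := by
    rw [← hldimM, ldim_eq_ldim_inf X ΛM, ldim_eq_ldim_inf X V]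
    have hXVfg : IsFG (X ⊓ V) X := hXfg.of_le_left bot_le
    rw [ldim_add (inf_le_inf_left X hV : X ⊓ V ≤ X ⊓ ΛM) inf_le_left hXVfg]
    exact Nat.le_add_left _ _
  -- (7) assemble
  have htdne : td V X ≠ ⊤ := td_ne_top (hXfg.of_le_left bot_le)
  have hn_td : (n : ℕ∞) ≤ td V X := by
    have h1 : (ldim V X : ℤ) ≤ ((td V X).toNat : ℤ) := by
      have := hpVX
      rw [predim_def] at this
      linarith
    have h2 : n ≤ (td V X).toNat := by
      have : ldim V X ≤ (td V X).toNat := by exact_mod_cast h1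
      exact hldim.trans this
    calc (n : ℕ∞) ≤ ((td V X).toNat : ℕ∞) := by exact_mod_cast h2
      _ = td V X := ENat.coe_toNat htdne
  have hfinal : (n : ℕ∞) ≤ Cardinal.toENat (Algebra.trdeg M (IntermediateField.adjoin M S)) := by
    rw [toENat_trdeg_adjoin_eq_relRank M S, hρ]
    exact hn_td.trans (htdle.trans hle1)
  exact Cardinal.natCast_le_toENat.1 hfinal

/-! ## Exactness of the split: `(R) ⟺ A ∧ B` -/

section Split

open Complex IntermediateField

/-- Stub A, verbatim registered signature. -/
def StubA : Prop :=
  ∀ (n : ℕ) (x : Fin n → ℂ), (∀ i, x i ∈ (sInf {K : IntermediateField ℚ ℂ | (∀ w ∈ K, Complex.exp w ∈ K) ∧ ∀ w : ℂ, IsAlgebraic K w → w ∈ K} : IntermediateField ℚ ℂ)) → LinearIndependent ℚ x → (n : Cardinal) ≤ Algebra.trdeg ℚ ↥(IntermediateField.adjoin ℚ (Set.range x ∪ Set.range (Complex.exp ∘ x)))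

/-- `(R) ⟹ A` (`M ≤ C_EA`). -/
theorem stubA_of_crux (h : Crux) : StubA := fun n x hx hli => h n x (fun i => M_le_CEA (hx i)) hli

/-- Schanuel's statement for tuples from `K` (skeleton vocabulary). -/
def SchanuelOn (K : IntermediateField ℚ ℂ) : Prop :=
  ∀ (n : ℕ) (x : Fin n → ℂ), (∀ i, x i ∈ K) → LinearIndependent ℚ x →
    (n : Cardinal) ≤ Algebra.trdeg ℚ
      ↥(IntermediateField.adjoin ℚ (Set.range x ∪ Set.range (Complex.exp ∘ x)))

/-- Relative Schanuel of `L` over `M` (skeleton vocabulary). -/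
def RelSchanuel (L M : IntermediateField ℚ ℂ) : Prop :=
  ∀ (n : ℕ) (x : Fin n → ℂ), (∀ i, x i ∈ L) →
    LinearIndependent ℚ ((Submodule.span ℚ (M : Set ℂ)).mkQ ∘ x) →
      (n : Cardinal) ≤ Algebra.trdeg ↥M
        ↥(IntermediateField.adjoin ↥M (Set.range x ∪ Set.range (Complex.exp ∘ x)))

example : Crux ↔ SchanuelOn CEA := Iff.rfl
example : StubA ↔ SchanuelOn M := Iff.rfl
example : StubB ↔ RelSchanuel CEA M := Iff.rfl

-- `horizontalSplit` below is COPIED VERBATIM from the line skeleton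
-- `Cruxes/SchanuelOnLogFreeCore/Lines/generic-period-fibre.lean` (planner-cruxplan, sorry-free there),
-- only so that this evidence file is self-contained; no originality is claimed for it.
open Submodule in
/-- **Horizontal split (general form).** For intermediate fields `M, L` of `ℂ/ℚ` with `M`
closed under `exp`: Schanuel on `M` and relative Schanuel of `L` over `M` give Schanuel on `L`.
Adapted basis `span x = (span x ∩ M) ⊕ U`, Schanuel on `M` for a basis `y'` of the first summand,
`Rel_M` for a basis `z'` of the second (independent modulo `M`), base change along
`ℚ(y', e^{y'}) ≤ M` (`trdeg_adjoin_le_of_le`) and the tower law (`add_le_trdeg_adjoin_union`) —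
the architecture of the tree's `schanuelConjecture_iff_ecl_empty_of_kirby` with `ecl ∅ ↦ M`. -/
theorem horizontalSplit {M L : IntermediateField ℚ ℂ} (hMexp : ∀ w ∈ M, Complex.exp w ∈ M)
    (hA : SchanuelOn M) (hB : RelSchanuel L M) : SchanuelOn L := by
  intro n x hxL hx
  -- `M` and `L` as `ℚ`-subspaces of `ℂ`
  let Eq : Submodule ℚ ℂ := Subalgebra.toSubmodule M.toSubalgebra
  have hEq : (Eq : Set ℂ) = (M : Set ℂ) := rfl
  have hspanE : span ℚ (M : Set ℂ) = Eq := by rw [← hEq, span_eq]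
  let Lq : Submodule ℚ ℂ := Subalgebra.toSubmodule L.toSubalgebra
  -- the `ℚ`-span `V` of `x̄`, `W = V ∩ M` and a complement `U` of `W` in `V`
  set V : Submodule ℚ ℂ := span ℚ (Set.range x) with hV
  have hVL : V ≤ Lq := span_le.mpr (Set.range_subset_iff.mpr hxL)
  haveI : FiniteDimensional ℚ V := FiniteDimensional.span_of_finite ℚ (Set.finite_range x)
  set W : Submodule ℚ ℂ := V ⊓ Eq with hW
  obtain ⟨U', hU'⟩ := W.exists_isCompl
  set U : Submodule ℚ ℂ := V ⊓ U' with hU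
  haveI : FiniteDimensional ℚ W := Submodule.finiteDimensional_of_le inf_le_left
  haveI : FiniteDimensional ℚ U := Submodule.finiteDimensional_of_le inf_le_left
  have hWU_sup : W ⊔ U = V := by
    rw [hU, inf_comm, ← sup_inf_assoc_of_le U' (inf_le_left : W ≤ V), hU'.sup_eq_top, top_inf_eq]
  have hWU_disj : Disjoint W U := hU'.disjoint.mono_right inf_le_right
  have hUE_disj : Disjoint U Eq := by
    rw [disjoint_def]
    intro a haU haE
    exact (disjoint_def.mp hWU_disj) a ⟨inf_le_left (b := U') haU, haE⟩ haU
  -- dimensions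
  set k := Module.finrank ℚ W
  set m := Module.finrank ℚ U
  have hn : k + m = n := by
    have h1 := Submodule.finrank_sup_add_finrank_inf_eq W U
    rw [hWU_disj.eq_bot, finrank_bot, add_zero, hWU_sup] at h1
    rw [← h1, hV, finrank_span_eq_card hx, Fintype.card_fin]
  -- bases
  let bW := Module.finBasis ℚ W
  let bU := Module.finBasis ℚ U
  let y : Fin k → ℂ := fun i => (bW i : ℂ)
  let z : Fin m → ℂ := fun j => (bU j : ℂ)
  have hy_mem : ∀ i, y i ∈ M := fun i => ((bW i).2 : (bW i : ℂ) ∈ V ⊓ Eq).2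
  have hy_V : ∀ i, y i ∈ V := fun i => ((bW i).2 : (bW i : ℂ) ∈ V ⊓ Eq).1
  have hz_U : ∀ j, z j ∈ U := fun j => (bU j).2
  have hz_V : ∀ j, z j ∈ V := fun j => inf_le_left (b := U') (hz_U j)
  have hy_li : LinearIndependent ℚ y := bW.linearIndependent.map' W.subtype W.ker_subtype
  have hz_li : LinearIndependent ℚ z := bU.linearIndependent.map' U.subtype U.ker_subtype
  -- clearing denominators
  choose Ny hNy hNy_mem using fun i => exists_nsmul_mem_span_int x (hy_V i)
  choose Nz hNz hNz_mem using fun j => exists_nsmul_mem_span_int x (hz_V j)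
  let cy : Fin k → ℚˣ := fun i => Units.mk0 (Ny i : ℚ) (Nat.cast_ne_zero.mpr (hNy i))
  let cz : Fin m → ℚˣ := fun j => Units.mk0 (Nz j : ℚ) (Nat.cast_ne_zero.mpr (hNz j))
  let y' : Fin k → ℂ := fun i => (Ny i : ℚ) • y i
  let z' : Fin m → ℂ := fun j => (Nz j : ℚ) • z j
  have hy'_eq : cy • y = y' := by
    funext i; simp only [Pi.smul_apply', cy, y', Units.smul_def, Units.val_mk0]
  have hz'_eq : cz • z = z' := by
    funext j; simp only [Pi.smul_apply', cz, z', Units.smul_def, Units.val_mk0]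
  have hy'_li : LinearIndependent ℚ y' := hy'_eq ▸ hy_li.units_smul cy
  have hz'_li : LinearIndependent ℚ z' := hz'_eq ▸ hz_li.units_smul cz
  have hy'_mem : ∀ i, y' i ∈ M := fun i => Eq.smul_mem _ (hy_mem i)
  have hz'_U : ∀ j, z' j ∈ U := fun j => U.smul_mem _ (hz_U j)
  have hz'_L : ∀ j, z' j ∈ L := fun j => hVL (inf_le_left (b := U') (hz'_U j))
  have hz'_modE : LinearIndependent ℚ ((span ℚ (M : Set ℂ)).mkQ ∘ z') := by
    refine hz'_li.map ?_
    rw [ker_mkQ, hspanE]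
    exact hUE_disj.mono_left (span_le.mpr (Set.range_subset_iff.mpr hz'_U))
  -- the field-theoretic estimate
  set Sy := Set.range y' ∪ Set.range (Complex.exp ∘ y') with hSy
  set Sz := Set.range z' ∪ Set.range (Complex.exp ∘ z') with hSz
  set Ky := adjoin ℚ Sy with hKy
  have hk : (k : Cardinal) ≤ Algebra.trdeg ℚ Ky := hA k y' hy'_mem hy'_li
  have hm₀ : (m : Cardinal) ≤ Algebra.trdeg M (adjoin M Sz) := hB m z' hz'_L hz'_modE
  have hKyM : Ky ≤ M := by
    rw [hKy, adjoin_le_iff]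
    rintro a (⟨i, rfl⟩ | ⟨i, rfl⟩)
    · exact hy'_mem i
    · exact hMexp _ (hy'_mem i)
  have hm : (m : Cardinal) ≤ Algebra.trdeg Ky (adjoin Ky Sz) :=
    hm₀.trans (trdeg_adjoin_le_of_le hKyM Sz)
  have hkm : (k : Cardinal) + m ≤ Algebra.trdeg ℚ (adjoin ℚ (Sy ∪ Sz)) :=
    add_le_trdeg_adjoin_union Sy Sz hk hm
  -- comparison with `ℚ(x̄, e^{x̄})`
  set Kx := adjoin ℚ (Set.range x ∪ Set.range (Complex.exp ∘ x)) with hKx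
  have hle : adjoin ℚ (Sy ∪ Sz) ≤ Kx := by
    rw [adjoin_le_iff]
    rintro a ((⟨i, rfl⟩ | ⟨i, rfl⟩) | (⟨j, rfl⟩ | ⟨j, rfl⟩))
    · exact (mem_adjoin_of_mem_span_int x (hNy_mem i)).1
    · exact (mem_adjoin_of_mem_span_int x (hNy_mem i)).2
    · exact (mem_adjoin_of_mem_span_int x (hNz_mem j)).1
    · exact (mem_adjoin_of_mem_span_int x (hNz_mem j)).2
  have hfin : Algebra.trdeg ℚ (adjoin ℚ (Sy ∪ Sz)) ≤ Algebra.trdeg ℚ Kx :=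
    trdeg_le_of_injective (inclusion hle) (IntermediateField.inclusion_injective hle)
  calc (n : Cardinal) = (k : Cardinal) + m := by rw [← hn, Nat.cast_add]
    _ ≤ Algebra.trdeg ℚ (adjoin ℚ (Sy ∪ Sz)) := hkm
    _ ≤ Algebra.trdeg ℚ Kx := hfin


/-- **The split is exact**: `(R) ⟺ A ∧ B`. (`⇐` is the skeleton's `SchanuelOnLogFreeCore_of`;
`⇒` is `stubA_of_crux` and `stubB_of_crux`.) -/
theorem crux_iff_stubA_and_stubB : Crux ↔ (StubA ∧ StubB) :=
  ⟨fun h => ⟨stubA_of_crux h, stubB_of_crux h⟩,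
    fun h => horizontalSplit (M := M) (L := CEA) (fun _ hw => M_exp hw) h.1 h.2⟩

end Split

end DrefuteGPF

end
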